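import Mathlib
import HarnessLib

/-!
# R90-TF · S10 — THE GERM COEFFICIENT AT `t₀` OVER AN EXHAUSTIVE INJECTIVE CUT IS THE FINITE SUM OVER THE CUT: `Σ'_{t(c) = t₀} w(c) = Σᶠ_i w(cl i)`
# (the book-keeping behind «(13.8.3) … where the sum is over cuspidal π on G such that ψ_G(t(π)) = t», the (D4-d) block of S10 FILE D)

Cell `hodgecm-mathlib`, crux H413 (`stmt-HodgeConjecture-24833`, lane `--supports … --as helper`), route of record `HCCMUnconditional`; programme R90-TF
(brief `director/R90-BRIEF.v2.md` 1f40d54518340a35); typed by R90-C138-typ2 (g2) for S10 FILE D ED. 2 (`Lines/R90_S10_TFDecompositionD.lean` 806e42d45b021177,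
block `DiscreteCoeffAtT0Hyp`: «the `π` with `ψ_G(t(π)) = t₀` and `Tr π(φ ⊗ (frozen) ⊗ 1) ≠ 0` are exactly FILE B's exhaustive level cut `cl`, so
`cD_{t₀}(φ) = Σᶠ_i m_i · trG i φ`»; FILE B's fields `hexh` (exhaustive), `hfib` (members lie over `t₀`), `hcl` (injective), finitely supported per `φ`).
PURE MATHLIB, generic in the class type `C`, the germ type `Γ`, the weight `w : C → ℂ` and the cut `cl : ι → C`.
WHAT IT SAYS.  If every class of germ `t₀` with non-zero weight is a member of the injective cut `cl` (exhaustiveness), every member has germ `t₀`, and the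
weights of the members are finitely supported, then the fibre series at `t₀` IS the finite sum over the cut.
PROOF: the cut lifts to an injective map `ι → {c // evp c = t₀}` whose range contains the support of the weight, so `Function.Injective.tsum_eq` moves the
`tsum` to `ι`, where it is a `finsum` (`tsum_eq_finsum`).  THEOREMS ONLY (one public theorem; no `def`, no instance, no notation, no `sorry`).
HONEST LABEL: HC_CM is proved only modulo the 7 printed citations (2 remaining named inputs: hLiu418 = stmt-HodgeConjecture-24832, h413 = stmt-HodgeConjecture-24833)
until rung 0 closes; this file is summation book-keeping and proves no printed statement by itself.

## References
* [Rogawski1990] J. D. Rogawski, *Automorphic Representations of Unitary Groups in Three Variables*, Ann. of Math. Stud. 123 (1990), §13.8 display (13.8.3)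
  p. 218 («the sum is over cuspidal π on G such that ψ_G(t(π)) = t»), §13.7 line (3) p. 211.
-/

set_option autoImplicit false
-- the mandated namespace repeats the single-problem summit's segment (`HodgeConjecture.HodgeConjecture`)
set_option linter.dupNamespace false

noncomputable section

namespace Summit.HodgeConjecture.HodgeConjecture.R90.S10

/-- **Fibre sum over an exhaustive injective cut.**  Let `evp : C → Γ`, `w : C → ℂ`, `t₀ : Γ` and `cl : ι → C` injective with `evp (cl i) = t₀` for all `i`,
such that every `c` with `evp c = t₀` and `w c ≠ 0` lies in `range cl`, and `i ↦ w (cl i)` is finitely supported.  Then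
`Σ'_{c : evp c = t₀} w(c) = Σᶠ_i w(cl i)`.  At S10 FILE D's (D4-d) block (`w(c) := m(c) · Tr c(ΦG φ)`, `cl :=` FILE B's `t₀`-fibre family) this is «the sum
is over the cuspidal `π` with `ψ_G(t(π)) = t₀`» read as the finite sum `Σᶠ_i m_i · trG i φ` [Rogawski1990 (13.8.3) p. 218].
[cite: Rogawski1990, §13.8 (13.8.3) p. 218; §13.7 line (3) p. 211] -/
theorem fibreTsum_eq_finsum_of_exhaustive {C Γ ι : Type*} (evp : C → Γ) (w : C → ℂ) (t₀ : Γ) (cl : ι → C)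
    (hcl : Function.Injective cl) (hfib : ∀ i, evp (cl i) = t₀)
    (hexh : ∀ c, evp c = t₀ → w c ≠ 0 → c ∈ Set.range cl)
    (hfin : (Function.support fun i => w (cl i)).Finite) :
    ∑' q : {c : C // evp c = t₀}, w q.1 = ∑ᶠ i, w (cl i) := by
  -- the cut, lifted to the fibre
  let g : ι → {c : C // evp c = t₀} := fun i => ⟨cl i, hfib i⟩
  have hg : Function.Injective g := fun i j hij => hcl (congrArg (fun q : {c : C // evp c = t₀} => q.1) hij)
  -- the fibre weight is supported on the range of the lifted cut (exhaustiveness)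
  have hsupp : Function.support (fun q : {c : C // evp c = t₀} => w q.1) ⊆ Set.range g := by
    rintro ⟨c, hc⟩ hw
    obtain ⟨i, hi⟩ := hexh c hc hw
    exact ⟨i, Subtype.ext hi⟩
  have h1 : ∑' i, w (cl i) = ∑' q : {c : C // evp c = t₀}, w q.1 :=
    hg.tsum_eq (f := fun q : {c : C // evp c = t₀} => w q.1) hsupp
  rw [← h1, tsum_eq_finsum hfin]

end Summit.HodgeConjecture.HodgeConjecture.R90.S10

end
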